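import Mathlib

/-!
# Stub `stub_flatteningLogLipschitz` of the line `ideator2-Sketch` (idea `impact-disc-flattening`)
# for the crux `InformationPercolationEngine.PercolationClosesChaos` (stmt-AtomisticToContinuum-15178)

Sorry-free discharge of the registered stub `stub_flatteningLogLipschitz` of the lead's skeleton
(`work/PercolationClosesChaos.lean`, §0 / S2): the thin-set / impact-disc corollary of the card's flattening lemma.

**Statement.** Let `ν` be a finite measure on a pseudo-metric measurable space `E` that is carried by a set `s`
(`x ∈ s` for `ν`-a.e. `x`) of diameter `≤ D`, let `x₀ ∈ s`, let `φ : E → ℝ` be a.e. strongly measurable and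
`L`-Lipschitz on `s` (`|φ x - φ y| ≤ L · dist x y` for `x, y ∈ s`, `L ≥ 0`), and let `g` be an a.e. strongly
measurable test with `|g| ≤ C` a.e. Then, writing `V := ν.real univ`,
`|(∫ g · e^φ) · V - (∫ g) · (∫ e^φ)| ≤ 2 · (e^{2LD} - 1) · C · e^{φ x₀ - LD} · V²`.

**Proof.** Pinching: for `ν`-a.e. `x` (namely every `x ∈ s`), `|φ x - φ x₀| ≤ L · dist x x₀ ≤ L · D`, so with
`m := e^{φ x₀ - LD}` and `η := e^{2LD} - 1 ≥ 0` one has `m ≤ e^{φ x} ≤ e^{φ x₀ + LD} = m · e^{2LD} = m (1 + η)`.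
Then the abstract flattening inequality (re-proved here as the private `flattening_aux`; its tree-level statement is
the neighbouring stub `stub_flattening` of the same skeleton): for `m ≤ f ≤ m (1 + η)` and `|g| ≤ C` a.e.,
`(∫ g f) · V - (∫ g)(∫ f) = (∫ g (f - m)) · V - (∫ g)(∫ (f - m))` (the constant `m` cancels in the product form),
and `|∫ g (f - m)| ≤ C m η V`, `|∫ g| ≤ C V`, `|∫ (f - m)| ≤ m η V` (an a.e. bounded function on a finite measure
space integrates to at most bound × mass), whence the bound `2 η C m V²`.

Mathlib only; no named facts.
-/

noncomputable section

open MeasureTheory Set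

namespace Summit.AtomisticToContinuum.HydrodynamicLimit.Theorems.ImpactDiscFlatteningLine

/-- The abstract flattening inequality (private copy for self-containedness; the tree-level statement is the
neighbouring stub `stub_flattening`): on a finite measure space, if `m ≤ f ≤ m (1 + η)` and `|g| ≤ C` hold
`ν`-a.e. (`m, η, C ≥ 0`, `f, g` a.e. strongly measurable), then
`|(∫ g f) · ν.real univ - (∫ g) · (∫ f)| ≤ 2 η C m · (ν.real univ)²`.
Proof: subtract the constant `m` inside both integrals (it cancels in the product form) and bound the three
remaining integrals by (a.e. sup-norm) × (total mass). -/
private theorem flattening_aux {E : Type*} [MeasurableSpace E] (ν : Measure E) [IsFiniteMeasure ν]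
    (f g : E → ℝ) (m η C : ℝ) (hm : 0 ≤ m) (hη : 0 ≤ η) (hC : 0 ≤ C) (hf : AEStronglyMeasurable f ν)
    (hg : AEStronglyMeasurable g ν) (hpinch : ∀ᵐ x ∂ν, m ≤ f x ∧ f x ≤ m * (1 + η))
    (hbound : ∀ᵐ x ∂ν, |g x| ≤ C) :
    |(∫ x, g x * f x ∂ν) * ν.real univ - (∫ x, g x ∂ν) * (∫ x, f x ∂ν)| ≤
      2 * η * C * m * ν.real univ ^ 2 := by
  have hV0 : 0 ≤ ν.real univ := measureReal_nonneg
  -- a.e. bounds on `f`, `g`, `f - m` and `g · (f - m)`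
  have hf_bd : ∀ᵐ x ∂ν, ‖f x‖ ≤ m * (1 + η) := by
    filter_upwards [hpinch] with x hx
    rw [Real.norm_eq_abs, abs_of_nonneg (hm.trans hx.1)]
    exact hx.2
  have hg_bd : ∀ᵐ x ∂ν, ‖g x‖ ≤ C := by
    filter_upwards [hbound] with x hx
    rw [Real.norm_eq_abs]
    exact hx
  have hh_bd : ∀ᵐ x ∂ν, ‖f x - m‖ ≤ m * η := by
    filter_upwards [hpinch] with x hx
    rw [Real.norm_eq_abs, abs_of_nonneg (sub_nonneg.mpr hx.1)]
    linarith [hx.2]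
  have hgh_bd : ∀ᵐ x ∂ν, ‖g x * (f x - m)‖ ≤ C * (m * η) := by
    filter_upwards [hg_bd, hh_bd] with x hgx hhx
    rw [norm_mul]
    exact mul_le_mul hgx hhx (norm_nonneg _) hC
  -- integrability (a.e. bounded on a finite measure space)
  have hf_int : Integrable f ν := Integrable.of_bound hf _ hf_bd
  have hg_int : Integrable g ν := Integrable.of_bound hg _ hg_bd
  have hgf_int : Integrable (fun x => g x * f x) ν := by
    refine Integrable.of_bound (hg.mul hf) (C * (m * (1 + η))) ?_
    filter_upwards [hg_bd, hf_bd] with x hgx hfx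
    rw [norm_mul]
    exact mul_le_mul hgx hfx (norm_nonneg _) hC
  -- the constant `m` cancels in the product form
  have h_gh : ∫ x, g x * (f x - m) ∂ν = (∫ x, g x * f x ∂ν) - m * ∫ x, g x ∂ν := by
    have hfun : (fun x => g x * (f x - m)) = fun x => g x * f x - m * g x := by
      funext x
      ring
    rw [hfun, integral_sub hgf_int (hg_int.const_mul m), integral_const_mul]
  have h_h : ∫ x, (f x - m) ∂ν = (∫ x, f x ∂ν) - m * ν.real univ := by
    rw [integral_sub hf_int (integrable_const m), integral_const, smul_eq_mul, mul_comm]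
  have key : (∫ x, g x * f x ∂ν) * ν.real univ - (∫ x, g x ∂ν) * (∫ x, f x ∂ν) =
      (∫ x, g x * (f x - m) ∂ν) * ν.real univ - (∫ x, g x ∂ν) * (∫ x, (f x - m) ∂ν) := by
    rw [h_gh, h_h]
    ring
  -- the three (sup-norm) × (mass) bounds
  have b1 : |∫ x, g x * (f x - m) ∂ν| ≤ C * (m * η) * ν.real univ := by
    rw [← Real.norm_eq_abs]
    exact norm_integral_le_of_norm_le_const hgh_bd
  have b2 : |∫ x, g x ∂ν| ≤ C * ν.real univ := by
    rw [← Real.norm_eq_abs]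
    exact norm_integral_le_of_norm_le_const hg_bd
  have b3 : |∫ x, (f x - m) ∂ν| ≤ m * η * ν.real univ := by
    rw [← Real.norm_eq_abs]
    exact norm_integral_le_of_norm_le_const hh_bd
  rw [key]
  calc |(∫ x, g x * (f x - m) ∂ν) * ν.real univ - (∫ x, g x ∂ν) * (∫ x, (f x - m) ∂ν)|
      ≤ |(∫ x, g x * (f x - m) ∂ν) * ν.real univ| + |(∫ x, g x ∂ν) * (∫ x, (f x - m) ∂ν)| :=
        abs_sub _ _
    _ = |∫ x, g x * (f x - m) ∂ν| * ν.real univ + |∫ x, (f x - m) ∂ν| * |∫ x, g x ∂ν| := by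
        rw [abs_mul, abs_mul, abs_of_nonneg hV0, mul_comm |∫ x, g x ∂ν|]
    _ ≤ C * (m * η) * ν.real univ * ν.real univ + m * η * ν.real univ * (C * ν.real univ) :=
        add_le_add (mul_le_mul_of_nonneg_right b1 hV0)
          (mul_le_mul b3 b2 (abs_nonneg _) (mul_nonneg (mul_nonneg hm hη) hV0))
    _ = 2 * η * C * m * ν.real univ ^ 2 := by ring

/-- S2 `stub_flatteningLogLipschitz` — the thin-set / impact-disc corollary of the flattening lemma. If the finite
measure `ν` is carried by a set `s` of diameter `≤ D` containing `x₀`, `φ` is `L`-Lipschitz on `s` (`L ≥ 0`) and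
a.e. strongly measurable, and the a.e. strongly measurable test `g` satisfies `|g| ≤ C` a.e., then
`|(∫ g e^φ) · ν.real univ - (∫ g)(∫ e^φ)| ≤ 2 (e^{2LD} - 1) C e^{φ x₀ - LD} (ν.real univ)²`.
Proof: a.e. `|φ x - φ x₀| ≤ L D`, so `e^φ` is pinched between `m := e^{φ x₀ - LD}` and
`e^{φ x₀ + LD} = m (1 + η)` with `η := e^{2LD} - 1 ≥ 0`; conclude by the abstract flattening inequality
(`flattening_aux`). The impact disc / the central spot of a virtual-pass disc is the instance `E = ℝ²`, `D = 2ε`. -/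
theorem stub_flatteningLogLipschitz {E : Type*} [PseudoMetricSpace E] [MeasurableSpace E] (ν : Measure E)
    [IsFiniteMeasure ν] (s : Set E) (φ g : E → ℝ) (x₀ : E) (D L C : ℝ) (hD : 0 ≤ D) (hL : 0 ≤ L) (hC : 0 ≤ C)
    (hx₀ : x₀ ∈ s) (hν : ∀ᵐ x ∂ν, x ∈ s) (hdiam : ∀ x ∈ s, ∀ y ∈ s, dist x y ≤ D)
    (hφ : ∀ x ∈ s, ∀ y ∈ s, |φ x - φ y| ≤ L * dist x y) (hφm : AEStronglyMeasurable φ ν)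
    (hg : AEStronglyMeasurable g ν) (hbound : ∀ᵐ x ∂ν, |g x| ≤ C) :
    |(∫ x, g x * Real.exp (φ x) ∂ν) * ν.real Set.univ - (∫ x, g x ∂ν) * (∫ x, Real.exp (φ x) ∂ν)| ≤
      2 * (Real.exp (2 * L * D) - 1) * C * Real.exp (φ x₀ - L * D) * ν.real Set.univ ^ 2 := by
  -- the pinching constants
  have hm : 0 ≤ Real.exp (φ x₀ - L * D) := (Real.exp_pos _).le
  have hLD : 0 ≤ 2 * L * D := by positivity
  have hη : 0 ≤ Real.exp (2 * L * D) - 1 := by linarith [Real.one_le_exp hLD]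
  -- `e^φ` is a.e. strongly measurable
  have hfm : AEStronglyMeasurable (fun x => Real.exp (φ x)) ν :=
    Real.continuous_exp.comp_aestronglyMeasurable hφm
  -- pinching: a.e. `m ≤ e^{φ x} ≤ m (1 + η)`
  have hpinch : ∀ᵐ x ∂ν, Real.exp (φ x₀ - L * D) ≤ Real.exp (φ x) ∧
      Real.exp (φ x) ≤ Real.exp (φ x₀ - L * D) * (1 + (Real.exp (2 * L * D) - 1)) := by
    filter_upwards [hν] with x hx
    have h1 : |φ x - φ x₀| ≤ L * D :=
      (hφ x hx x₀ hx₀).trans (mul_le_mul_of_nonneg_left (hdiam x hx x₀ hx₀) hL)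
    rw [abs_le] at h1
    constructor
    · exact Real.exp_le_exp.mpr (by linarith [h1.1])
    · rw [add_sub_cancel, ← Real.exp_add]
      exact Real.exp_le_exp.mpr (by linarith [h1.2])
  exact flattening_aux ν (fun x => Real.exp (φ x)) g (Real.exp (φ x₀ - L * D)) (Real.exp (2 * L * D) - 1) C
    hm hη hC hfm hg hpinch hbound

end Summit.AtomisticToContinuum.HydrodynamicLimit.Theorems.ImpactDiscFlatteningLine

end
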